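import Literature.Computability.MetaComplexity.ChenJinSanthanamWilliams2022.OneTapeRefuterMagnificationRAM

/-!
# `PAL` is decided in linear time on the word RAM — a verified program

Chen–Jin–Santhanam–Williams (FOCS 2021 / arXiv:2203.14379) state their one-tape refuter
magnification theorem in general form (Theorem 1.5, `theo:general`) for every language `L`
decidable in nondeterministic almost-linear time on a random-access machine, and instantiate
it at the palindromes `PAL = {w w^R}` (Theorem (thm:pal); §3.3 p. 13 L35: "In fact, we
will prove a much more general statement. We will also generalize the proof to show that for
every language $L$ computable by nondeterministic $n^{1 + o(1)}$-time RAMs, …"; p. 14 L25: "Now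
we are ready to generalize Theorem (thm:pal) to other problems."). That `PAL` satisfies the
general theorem's premise — it is decidable in deterministic LINEAR time on a RAM — is
folklore and is not spelled out in print. The sister files type the instance (`thmPal_PNP`,
`OneTapeRefuterMagnification.lean`) and the general form (`thm15_general` over the
nondeterministic word-RAM time class `NTIMERAMAlmostLinear`, device D16e,
`OneTapeRefuterMagnificationRAM.lean`), and prove the instance relation
`thmPal_PNP_of_general : thm15_general → PAL ∈ NTIMERAMAlmostLinear → thmPal_PNP` with the
membership left as a hypothesis.

This file DISCHARGES that hypothesis: it writes down a 23-instruction word-RAM program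
`palProg` (model `Literature.Computability.Cryptography.WordRAM`, input convention D16 of
`ChenJinWilliams2019/UniformAdviceRAM.lean`: cell `0` = `n + 1`, cell `1` = `n`, cells
`2 … n+1` = the bits, word size `w = inputWidth`, no advice, no oracle, no coins) and VERIFIES
that it decides `PAL` within `7·n + 7` steps on every input of length `n`
(`palProg_decides`). Consequences: `PAL ∈ DTIMERAM (fun n => n)` (`PAL_mem_DTIMERAM`) — the
first non-trivial language placed in any of the word-RAM time classes of the census (so far
only `0` and `⊤` were: `zero_mem_*`, `top_mem_*`), `PAL ∈ NTIMERAMAlmostLinear`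
(`PAL_mem_NTIMERAMAlmostLinear`), and the now unconditional instance relation
`thmPal_PNP_of_thm15_general : thm15_general → thmPal_PNP`.

The program: cells `0`/`1` serve as the back/front pointers `j`/`i` (initially `j = n + 1`,
the address of the last bit; `i := 2`, the address of the first bit, after the parity test
`n % 2 = 0`); the loop compares the bits at `i` and `j` with two indirect conditional jumps,
advances `i += 1`, `j -= 1`, and continues while `i < j`, the comparison bit being kept in
cell `2` (whose input bit `x₀` is dead after the first comparison); it answers `[1]`/`[0]` by
writing the output length `1` to cell `0` and the answer to cell `1`. Correctness is the loop
invariant `LoopInv` plus the list lemma `mem_PAL_iff_mirror`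
(`x ∈ PAL ↔ |x| even ∧ ∀ t < |x|/2, x_t = x_{|x|-1-t}`). Everything here is folklore
("PAL ∈ DTIME[n]", loc. cit.); no new cited fact, no `sorry`.
-/

namespace Literature.Computability.MetaComplexity.ChenJinSanthanamWilliams2022

open Literature.Computability.Cryptography Literature.Computability.Cryptography.WordRAM
open Literature.Computability.MetaComplexity.ChenJinWilliams2019

/-! ## The list lemma: palindromes of even length by mirrored positions -/

/-- `x ∈ PAL` iff `x` has even length and mirrored positions carry equal bits. [folklore] -/
theorem mem_PAL_iff_mirror (x : List Bool) :
    x ∈ PAL ↔ Even x.length ∧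
      ∀ t, t < x.length / 2 → x.getD t false = x.getD (x.length - 1 - t) false := by
  constructor
  · rintro ⟨y, rfl⟩
    refine ⟨⟨y.length, by simp⟩, fun t ht => ?_⟩
    have hlen : (y.reverse ++ y).length = y.length + y.length := by simp
    rw [hlen] at ht ⊢
    have ht' : t < y.length := by omega
    rw [List.getD_eq_getElem _ _ (by simp; omega), List.getD_eq_getElem _ _ (by simp; omega),
      List.getElem_append_left (by simpa using ht'),
      List.getElem_append_right (by simp; omega), List.getElem_reverse]
    congr 1
    simp only [List.length_reverse]
    omega
  · rintro ⟨⟨r, hr⟩, hmir⟩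
    refine ⟨x.drop r, ?_⟩
    have hxl : x.length = r + r := hr
    have hdiv : x.length / 2 = r := by omega
    apply List.ext_getElem
    · simp; omega
    · intro t h₁ h₂
      by_cases ht : t < r
      · rw [List.getElem_append_left (by simpa using (by omega : t < x.length - r)),
          List.getElem_reverse, List.getElem_drop]
        have hm := hmir t (by omega)
        rw [List.getD_eq_getElem _ _ (by omega), List.getD_eq_getElem _ _ (by omega)] at hm
        rw [hm]
        congr 1
        simp only [List.length_drop]
        omega
      · rw [List.getElem_append_right (by simp; omega), List.getElem_drop]
        congr 1
        simp only [List.length_reverse, List.length_drop]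
        omega

/-! ## The program -/

/-- The palindrome decider (23 instructions; see the file header for the layout).
`0`: `n = 0` → accept · `1–3`: parity test · `4`: `i := 2` · `5–9`: compare the bits at `i`
(cell `1`, indirect) and `j` (cell `0`, indirect) · `10–14`: advance and loop while `i < j` ·
`16–18`: accept (`[1]`) · `19–21`: reject (`[0]`) · `22`: trampoline equalising path lengths.
[folklore] -/
def palProg : Program :=
  [ .jz (.dir 1) 16,                      -- 0
    .op .mod (.dir 1) (.dir 1) (.imm 2),   -- 1
    .jz (.dir 1) 4,                        -- 2
    .jmp 19,                               -- 3
    .op .div (.dir 1) (.imm 4) (.imm 2),   -- 4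
    .jz (.ind 1) 8,                        -- 5
    .jz (.ind 0) 19,                       -- 6
    .jmp 10,                               -- 7
    .jz (.ind 0) 22,                       -- 8
    .jmp 19,                               -- 9
    .op .add (.dir 1) (.dir 1) (.imm 1),   -- 10
    .op .sub (.dir 0) (.dir 0) (.imm 1),   -- 11
    .op .lt (.dir 2) (.dir 1) (.dir 0),    -- 12
    .jz (.dir 2) 16,                       -- 13
    .jmp 5,                                -- 14
    .halt,                                 -- 15
    .op .lt (.dir 0) (.imm 0) (.imm 1),    -- 16
    .op .lt (.dir 1) (.imm 0) (.imm 1),    -- 17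
    .halt,                                 -- 18
    .op .lt (.dir 0) (.imm 0) (.imm 1),    -- 19
    .op .lt (.dir 1) (.imm 1) (.imm 0),    -- 20
    .halt,                                 -- 21
    .jmp 10 ]                              -- 22

/-- `palProg` makes no oracle queries. [folklore] -/
theorem palProg_isOracleFree : palProg.IsOracleFree := by
  intro ins h
  simp [palProg] at h
  rcases h with h | h | h | h | h | h | h | h | h | h | h | h | h | h | h | h | h | h | h | h |
    h | h | h <;> subst h <;> simp [Instr.isQuery]

/-- `palProg` draws no coins. [folklore] -/
theorem palProg_isDeterministic : palProg.IsDeterministic := by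
  intro ins h
  simp [palProg] at h
  rcases h with h | h | h | h | h | h | h | h | h | h | h | h | h | h | h | h | h | h | h | h |
    h | h | h <;> subst h <;> simp [Instr.isRand]

/-- The configurations of a run of `palProg`: no coins consumed, no queries logged. [folklore] -/
abbrev mk (pc : ℕ) (m : ℕ → ℕ) : Cfg :=
  { pc := some pc, mem := m, coinPos := 0, queries := [] }

/-- The halted configurations of a run of `palProg`. [folklore] -/
abbrev fin (m : ℕ → ℕ) : Cfg :=
  { pc := none, mem := m, coinPos := 0, queries := [] }

section steps

variable (w : ℕ) (O : List ℕ → List ℕ) (ρ : ℕ → ℕ) (m : ℕ → ℕ)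

/-- A step equation of `palProg`. [folklore] -/
theorem step0_zero (h : m 1 = 0) : step palProg w O ρ (mk 0 m) = some (mk 16 m) :=
  step_jz_zero (i := 0) rfl (by rfl) (by simpa using h)
/-- A step equation of `palProg`. [folklore] -/
theorem step0_ne (h : m 1 ≠ 0) : step palProg w O ρ (mk 0 m) = some (mk 1 m) :=
  step_jz_ne (i := 0) rfl (by rfl) (by simpa using h)
/-- A step equation of `palProg`. [folklore] -/
theorem step1 : step palProg w O ρ (mk 1 m) = some (mk 2 (Function.update m 1 (m 1 % 2))) := by
  rw [step_op (i := 1) rfl (by rfl)]; rfl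
/-- A step equation of `palProg`. [folklore] -/
theorem step2_zero (h : m 1 = 0) : step palProg w O ρ (mk 2 m) = some (mk 4 m) :=
  step_jz_zero (i := 2) rfl (by rfl) (by simpa using h)
/-- A step equation of `palProg`. [folklore] -/
theorem step2_ne (h : m 1 ≠ 0) : step palProg w O ρ (mk 2 m) = some (mk 3 m) :=
  step_jz_ne (i := 2) rfl (by rfl) (by simpa using h)
/-- A step equation of `palProg`. [folklore] -/
theorem step3 : step palProg w O ρ (mk 3 m) = some (mk 19 m) := step_jmp (i := 3) rfl (by rfl)
/-- A step equation of `palProg`. [folklore] -/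
theorem step4 : step palProg w O ρ (mk 4 m) = some (mk 5 (Function.update m 1 2)) := by
  rw [step_op (i := 4) rfl (by rfl)]
  have h42 : BinOp.eval w .div 4 2 = 2 := by
    show (4 : ℕ) / 2 = 2
    decide
  simp only [Operand.read_imm, h42]
  rfl
/-- A step equation of `palProg`. [folklore] -/
theorem step5_zero (h : m (m 1) = 0) : step palProg w O ρ (mk 5 m) = some (mk 8 m) :=
  step_jz_zero (i := 5) rfl (by rfl) (by simpa using h)
/-- A step equation of `palProg`. [folklore] -/
theorem step5_ne (h : m (m 1) ≠ 0) : step palProg w O ρ (mk 5 m) = some (mk 6 m) :=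
  step_jz_ne (i := 5) rfl (by rfl) (by simpa using h)
/-- A step equation of `palProg`. [folklore] -/
theorem step6_zero (h : m (m 0) = 0) : step palProg w O ρ (mk 6 m) = some (mk 19 m) :=
  step_jz_zero (i := 6) rfl (by rfl) (by simpa using h)
/-- A step equation of `palProg`. [folklore] -/
theorem step6_ne (h : m (m 0) ≠ 0) : step palProg w O ρ (mk 6 m) = some (mk 7 m) :=
  step_jz_ne (i := 6) rfl (by rfl) (by simpa using h)
/-- A step equation of `palProg`. [folklore] -/
theorem step7 : step palProg w O ρ (mk 7 m) = some (mk 10 m) := step_jmp (i := 7) rfl (by rfl)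
/-- A step equation of `palProg`. [folklore] -/
theorem step8_zero (h : m (m 0) = 0) : step palProg w O ρ (mk 8 m) = some (mk 22 m) :=
  step_jz_zero (i := 8) rfl (by rfl) (by simpa using h)
/-- A step equation of `palProg`. [folklore] -/
theorem step8_ne (h : m (m 0) ≠ 0) : step palProg w O ρ (mk 8 m) = some (mk 9 m) :=
  step_jz_ne (i := 8) rfl (by rfl) (by simpa using h)
/-- A step equation of `palProg`. [folklore] -/
theorem step9 : step palProg w O ρ (mk 9 m) = some (mk 19 m) := step_jmp (i := 9) rfl (by rfl)
/-- A step equation of `palProg`. [folklore] -/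
theorem step10 : step palProg w O ρ (mk 10 m) =
    some (mk 11 (Function.update m 1 ((m 1 + 1) % 2 ^ w))) := by
  rw [step_op (i := 10) rfl (by rfl)]; rfl
/-- A step equation of `palProg`. [folklore] -/
theorem step11 : step palProg w O ρ (mk 11 m) =
    some (mk 12 (Function.update m 0 ((m 0 + 2 ^ w - 1 % 2 ^ w) % 2 ^ w))) := by
  rw [step_op (i := 11) rfl (by rfl)]; rfl
/-- A step equation of `palProg`. [folklore] -/
theorem step12 : step palProg w O ρ (mk 12 m) =
    some (mk 13 (Function.update m 2 (if m 1 < m 0 then 1 else 0))) := by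
  rw [step_op (i := 12) rfl (by rfl)]; rfl
/-- A step equation of `palProg`. [folklore] -/
theorem step13_zero (h : m 2 = 0) : step palProg w O ρ (mk 13 m) = some (mk 16 m) :=
  step_jz_zero (i := 13) rfl (by rfl) (by simpa using h)
/-- A step equation of `palProg`. [folklore] -/
theorem step13_ne (h : m 2 ≠ 0) : step palProg w O ρ (mk 13 m) = some (mk 14 m) :=
  step_jz_ne (i := 13) rfl (by rfl) (by simpa using h)
/-- A step equation of `palProg`. [folklore] -/
theorem step14 : step palProg w O ρ (mk 14 m) = some (mk 5 m) := step_jmp (i := 14) rfl (by rfl)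
/-- A step equation of `palProg`. [folklore] -/
theorem step16 : step palProg w O ρ (mk 16 m) = some (mk 17 (Function.update m 0 1)) := by
  rw [step_op (i := 16) rfl (by rfl)]; rfl
/-- A step equation of `palProg`. [folklore] -/
theorem step17 : step palProg w O ρ (mk 17 m) = some (mk 18 (Function.update m 1 1)) := by
  rw [step_op (i := 17) rfl (by rfl)]; rfl
/-- A step equation of `palProg`. [folklore] -/
theorem step18 : step palProg w O ρ (mk 18 m) = some (fin m) := step_halt (i := 18) rfl (by rfl)
/-- A step equation of `palProg`. [folklore] -/
theorem step19 : step palProg w O ρ (mk 19 m) = some (mk 20 (Function.update m 0 1)) := by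
  rw [step_op (i := 19) rfl (by rfl)]; rfl
/-- A step equation of `palProg`. [folklore] -/
theorem step20 : step palProg w O ρ (mk 20 m) = some (mk 21 (Function.update m 1 0)) := by
  rw [step_op (i := 20) rfl (by rfl)]; rfl
/-- A step equation of `palProg`. [folklore] -/
theorem step21 : step palProg w O ρ (mk 21 m) = some (fin m) := step_halt (i := 21) rfl (by rfl)
/-- A step equation of `palProg`. [folklore] -/
theorem step22 : step palProg w O ρ (mk 22 m) = some (mk 10 m) := step_jmp (i := 22) rfl (by rfl)

/-- A halted configuration makes no step. [folklore] -/
theorem step_fin : step palProg w O ρ (fin m) = none := step_of_pc_eq_none rfl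

end steps


/-! ## Straight-line segments -/

section segments

variable (w : ℕ) (O : List ℕ → List ℕ) (ρ : ℕ → ℕ)

/-- The accepting tail: write the output `[1]` and halt. [folklore] -/
theorem run_acc (m : ℕ → ℕ) :
    run palProg w O ρ 3 (mk 16 m) = some (fin (Function.update (Function.update m 0 1) 1 1)) := by
  rw [run_succ_of_step _ _ _ _ (step16 w O ρ m), run_succ_of_step _ _ _ _ (step17 w O ρ _), run_one,
    step18]

/-- The rejecting tail: write the output `[0]` and halt. [folklore] -/
theorem run_rej (m : ℕ → ℕ) :
    run palProg w O ρ 3 (mk 19 m) = some (fin (Function.update (Function.update m 0 1) 1 0)) := by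
  rw [run_succ_of_step _ _ _ _ (step19 w O ρ m), run_succ_of_step _ _ _ _ (step20 w O ρ _), run_one,
    step21]

/-- The accepting memory reads out `[1]`. [folklore] -/
theorem readOut_acc (m : ℕ → ℕ) : readOut (Function.update (Function.update m 0 1) 1 1) = [1] := by
  simp [readOut, readSeg]

/-- The rejecting memory reads out `[0]`. [folklore] -/
theorem readOut_rej (m : ℕ → ℕ) : readOut (Function.update (Function.update m 0 1) 1 0) = [0] := by
  simp [readOut, readSeg]

/-- Modular decrement of a positive word. [folklore] -/
theorem sub_one_eval {w J : ℕ} (hJ1 : 1 ≤ J) (hJ : J < 2 ^ w) :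
    (J + 2 ^ w - 1 % 2 ^ w) % 2 ^ w = J - 1 := by
  have h2 : 1 < 2 ^ w := lt_of_le_of_lt hJ1 hJ
  rw [Nat.mod_eq_of_lt h2, show J + 2 ^ w - 1 = (J - 1) + 2 ^ w by omega, Nat.add_mod_right,
    Nat.mod_eq_of_lt (by omega)]

/-- The memory after one advance `i += 1; j -= 1; cell 2 := [i < j]` from pointers `I`, `J`. [folklore] -/
def advMem (m : ℕ → ℕ) (I J : ℕ) : ℕ → ℕ :=
  Function.update (Function.update (Function.update m 1 (I + 1)) 0 (J - 1)) 2
    (if I + 1 < J - 1 then 1 else 0)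

/-- The advance segment `pc 10 → pc 13`. [folklore] -/
theorem run_adv (m : ℕ → ℕ) {I J : ℕ} (h0 : m 0 = J) (h1 : m 1 = I) (hI : I + 1 < 2 ^ w)
    (hJ1 : 1 ≤ J) (hJ : J < 2 ^ w) :
    run palProg w O ρ 3 (mk 10 m) = some (mk 13 (advMem m I J)) := by
  have e10 : step palProg w O ρ (mk 10 m) = some (mk 11 (Function.update m 1 (I + 1))) := by
    rw [step10, h1, Nat.mod_eq_of_lt hI]
  have hv0 : Function.update m 1 (I + 1) 0 = J := by
    rw [Function.update_of_ne (by norm_num), h0]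
  have e11 : step palProg w O ρ (mk 11 (Function.update m 1 (I + 1))) =
      some (mk 12 (Function.update (Function.update m 1 (I + 1)) 0 (J - 1))) := by
    rw [step11, hv0, sub_one_eval hJ1 hJ]
  have hv1 : Function.update (Function.update m 1 (I + 1)) 0 (J - 1) 1 = I + 1 := by
    rw [Function.update_of_ne (by norm_num), Function.update_self]
  have hv0' : Function.update (Function.update m 1 (I + 1)) 0 (J - 1) 0 = J - 1 :=
    Function.update_self ..
  have e12 : step palProg w O ρ (mk 12 (Function.update (Function.update m 1 (I + 1)) 0 (J - 1))) =
      some (mk 13 (advMem m I J)) := by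
    rw [step12, hv1, hv0']
    rfl
  rw [run_succ_of_step _ _ _ _ e10, run_succ_of_step _ _ _ _ e11, run_one, e12]

end segments

/-! ## The loop invariant and the loop -/

/-- The loop invariant at the loop head `pc = 5`, relative to the initial memory `M`: cell `0`
holds the back pointer `J`, cell `1` the front pointer `I`, cells `≥ 3` are untouched, and cell
`2` is untouched as long as it is still to be read (`I = 2`). [folklore] -/
structure LoopInv (M m : ℕ → ℕ) (I J : ℕ) : Prop where
  zero : m 0 = J
  one : m 1 = I
  rest : ∀ a, 3 ≤ a → m a = M a
  two : I = 2 → m 2 = M 2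

/-- `Mirror M I J d`: the `d` mirrored pairs `(I + t, J - t)`, `t < d`, carry equal contents. [folklore] -/
def Mirror (M : ℕ → ℕ) (I J d : ℕ) : Prop :=
  ∀ t, t < d → M (I + t) = M (J - t)

/-- One mirrored pair. [folklore] -/
theorem mirror_one (M : ℕ → ℕ) (I J : ℕ) : Mirror M I J 1 ↔ M I = M J := by
  constructor
  · intro h; simpa using h 0 Nat.one_pos
  · intro h t ht
    obtain rfl : t = 0 := by omega
    simpa using h

/-- Peeling the outermost mirrored pair. [folklore] -/
theorem mirror_succ (M : ℕ → ℕ) (I J d : ℕ) :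
    Mirror M I J (d + 1) ↔ M I = M J ∧ Mirror M (I + 1) (J - 1) d := by
  constructor
  · intro h
    refine ⟨by simpa using h 0 (by omega), fun t ht => ?_⟩
    have := h (t + 1) (by omega)
    rwa [show I + (t + 1) = I + 1 + t by omega, show J - (t + 1) = J - 1 - t by omega] at this
  · rintro ⟨h0, h⟩ t ht
    cases t with
    | zero => simpa using h0
    | succ t =>
      have := h t (by omega)
      rwa [show I + 1 + t = I + (t + 1) by omega, show J - 1 - t = J - (t + 1) by omega] at this

/-- Under the invariant, the indirect read through cell `1` returns the input bit at `I`. [folklore] -/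
theorem LoopInv.read_front {M m : ℕ → ℕ} {I J : ℕ} (inv : LoopInv M m I J) (hI : 2 ≤ I) :
    m (m 1) = M I := by
  rw [inv.one]
  by_cases h : I = 2
  · subst h; exact inv.two rfl
  · exact inv.rest I (by omega)

/-- Under the invariant, the indirect read through cell `0` returns the input bit at `J`. [folklore] -/
theorem LoopInv.read_back {M m : ℕ → ℕ} {I J : ℕ} (inv : LoopInv M m I J) (hJ : 3 ≤ J) :
    m (m 0) = M J := by
  rw [inv.zero]
  exact inv.rest J hJ

/-- The invariant survives the advance. [folklore] -/
theorem LoopInv.next {M m : ℕ → ℕ} {I J : ℕ} (inv : LoopInv M m I J) (hI : 2 ≤ I) :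
    LoopInv M (advMem m I J) (I + 1) (J - 1) where
  zero := by
    unfold advMem
    rw [Function.update_of_ne (by norm_num), Function.update_self]
  one := by
    unfold advMem
    rw [Function.update_of_ne (by norm_num), Function.update_of_ne (by norm_num),
      Function.update_self]
  rest a ha := by
    unfold advMem
    rw [Function.update_of_ne (by omega), Function.update_of_ne (by omega),
      Function.update_of_ne (by omega)]
    exact inv.rest a ha
  two h := absurd h (by omega)

/-- Cell `2` after the advance holds the comparison bit `[i < j]`. [folklore] -/
theorem advMem_two (m : ℕ → ℕ) (I J : ℕ) : advMem m I J 2 = if I + 1 < J - 1 then 1 else 0 :=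
  Function.update_self ..

section loop

variable (w : ℕ) (O : List ℕ → List ℕ) (ρ : ℕ → ℕ) (M : ℕ → ℕ)

/-- Comparing equal bits leads to the advance (`pc 10`) in three steps. [folklore] -/
theorem run_compare_eq {m : ℕ → ℕ} {I J : ℕ} (inv : LoopInv M m I J) (hI : 2 ≤ I) (hJ : 3 ≤ J)
    (heq : M I = M J) : run palProg w O ρ 3 (mk 5 m) = some (mk 10 m) := by
  have hf := inv.read_front hI
  have hb := inv.read_back hJ
  by_cases h0 : M I = 0
  · have e5 := step5_zero w O ρ m (by rw [hf, h0])
    have e8 := step8_zero w O ρ m (by rw [hb, ← heq, h0])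
    rw [run_succ_of_step _ _ _ _ e5, run_succ_of_step _ _ _ _ e8, run_one, step22]
  · have e5 := step5_ne w O ρ m (by rw [hf]; exact h0)
    have e6 := step6_ne w O ρ m (by rw [hb, ← heq]; exact h0)
    rw [run_succ_of_step _ _ _ _ e5, run_succ_of_step _ _ _ _ e6, run_one, step7]

/-- Comparing unequal bits leads to the rejecting tail (`pc 19`) within three steps. [folklore] -/
theorem run_compare_ne (hbits : ∀ a, 2 ≤ a → M a ≤ 1) {m : ℕ → ℕ} {I J : ℕ}
    (inv : LoopInv M m I J) (hI : 2 ≤ I) (hJ : 3 ≤ J) (hne : M I ≠ M J) : ∃ s, s ≤ 3 ∧ run palProg w O ρ s (mk 5 m) = some (mk 19 m) := by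
  have hf := inv.read_front hI
  have hb := inv.read_back hJ
  have hIle := hbits I hI
  have hJle := hbits J (by omega)
  by_cases h0 : M I = 0
  · have hJ0 : M J ≠ 0 := fun h => hne (h0.trans h.symm)
    have e5 := step5_zero w O ρ m (by rw [hf, h0])
    have e8 := step8_ne w O ρ m (by rw [hb]; exact hJ0)
    refine ⟨3, le_rfl, ?_⟩
    rw [run_succ_of_step _ _ _ _ e5, run_succ_of_step _ _ _ _ e8, run_one, step9]
  · have hJ0 : M J = 0 := by omega
    have e5 := step5_ne w O ρ m (by rw [hf]; exact h0)
    have e6 := step6_zero w O ρ m (by rw [hb, hJ0])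
    refine ⟨2, by norm_num, ?_⟩
    rw [run_succ_of_step _ _ _ _ e5, run_one, e6]

open Classical in
/-- **The loop.** From the loop head with invariant `LoopInv M m I J` and `d + 1` pairs still to
compare (`J = I + 2d + 1`), `palProg` halts within `8d + 11` steps with output `[1]` if the
pairs mirror and `[0]` otherwise. [folklore] -/
theorem loop_spec (hbits : ∀ a, 2 ≤ a → M a ≤ 1) :
    ∀ (d I J : ℕ) (m : ℕ → ℕ), J = I + 2 * d + 1 → 2 ≤ I → J < 2 ^ w →
    LoopInv M m I J →
    ∃ s mf, s ≤ 8 * d + 11 ∧ run palProg w O ρ s (mk 5 m) = some (fin mf) ∧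
      readOut mf = [if Mirror M I J (d + 1) then 1 else 0] := by
  intro d
  induction d with
  | zero =>
    intro I J m hJ hI hJw inv
    by_cases heq : M I = M J
    · have hc := run_compare_eq w O ρ M inv hI (by omega) heq
      have ha := run_adv w O ρ m inv.zero inv.one (by omega) (by omega) hJw
      have h2 : advMem m I J 2 = 0 := by rw [advMem_two, if_neg (by omega)]
      have e13 := step13_zero w O ρ _ h2
      have htail : run palProg w O ρ (3 + 1) (mk 13 (advMem m I J)) =
          some (fin (Function.update (Function.update (advMem m I J) 0 1) 1 1)) := by
        rw [run_succ_of_step _ _ _ _ e13, run_acc]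
      refine ⟨3 + (3 + (3 + 1)), _, by norm_num,
        run_add_of_run _ _ _ _ hc (run_add_of_run _ _ _ _ ha htail), ?_⟩
      rw [readOut_acc, if_pos ((mirror_one M I J).2 heq)]
    · obtain ⟨s, hs, hc⟩ := run_compare_ne w O ρ M hbits inv hI (by omega) heq
      refine ⟨s + 3, _, by omega, run_add_of_run _ _ _ _ hc (run_rej w O ρ m), ?_⟩
      rw [readOut_rej, if_neg (mt (mirror_one M I J).1 heq)]
  | succ d ih =>
    intro I J m hJ hI hJw inv
    by_cases heq : M I = M J
    · have hc := run_compare_eq w O ρ M inv hI (by omega) heq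
      have ha := run_adv w O ρ m inv.zero inv.one (by omega) (by omega) hJw
      have h2 : advMem m I J 2 ≠ 0 := by
        rw [advMem_two, if_pos (by omega)]; exact one_ne_zero
      have e13 := step13_ne w O ρ _ h2
      have e14 := step14 w O ρ (advMem m I J)
      obtain ⟨s', mf, hs', hrun', hout'⟩ :=
        ih (I + 1) (J - 1) (advMem m I J) (by omega) (by omega) (by omega) (inv.next hI)
      have htail : run palProg w O ρ (s' + 1 + 1) (mk 13 (advMem m I J)) = some (fin mf) := by
        rw [run_succ_of_step _ _ _ _ e13, run_succ_of_step _ _ _ _ e14, hrun']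
      refine ⟨3 + (3 + (s' + 1 + 1)), mf, by omega,
        run_add_of_run _ _ _ _ hc (run_add_of_run _ _ _ _ ha htail), ?_⟩
      rw [hout']
      have hiff : Mirror M I J (d + 1 + 1) ↔ Mirror M (I + 1) (J - 1) (d + 1) := by
        rw [mirror_succ]
        exact ⟨fun h => h.2, fun h => ⟨heq, h⟩⟩
      by_cases hP : Mirror M (I + 1) (J - 1) (d + 1)
      · rw [if_pos hP, if_pos (hiff.2 hP)]
      · rw [if_neg hP, if_neg (fun h => hP (hiff.1 h))]
    · obtain ⟨s, hs, hc⟩ := run_compare_ne w O ρ M hbits inv hI (by omega) heq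
      refine ⟨s + 3, _, by omega, run_add_of_run _ _ _ _ hc (run_rej w O ρ m), ?_⟩
      rw [readOut_rej, if_neg (fun h => heq ((mirror_succ M I J (d + 1)).1 h).1)]

end loop

/-! ## The initial memory of the run on `x` (D16: `k = 1`, no advice) -/

section initial

variable (x : List Bool)

/-- The D16 input list of `x` (no advice) has length `|x| + 1`. [folklore] -/
theorem length_advInput_nil : (advInput x []).length = x.length + 1 := by
  simp [advInput]

/-- The word size `w = 1 · inputWidth` is at least the input width. [folklore] -/
theorem inputWidth_le_advWordSize : inputWidth (advInput x []) ≤ advWordSize 1 x [] := by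
  unfold advWordSize; omega

/-- `n + 1 < 2 ^ w`: every pointer of the run fits in a word. [folklore] -/
theorem succ_length_lt_two_pow : x.length + 1 < 2 ^ advWordSize 1 x [] := by
  have h := length_lt_two_pow_inputWidth (advInput x [])
  rw [length_advInput_nil] at h
  exact lt_of_lt_of_le h (Nat.pow_le_pow_right Nat.two_pos (inputWidth_le_advWordSize x))

/-- Cell `0` initially holds `n + 1` (the length of the D16 input list). [folklore] -/
theorem initMem_zero : (init (advWordSize 1 x []) (advInput x [])).mem 0 = x.length + 1 := by
  rw [init_mem_zero_of_inputWidth_le (inputWidth_le_advWordSize x), length_advInput_nil]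

/-- Cell `1` initially holds `n`. [folklore] -/
theorem initMem_one : (init (advWordSize 1 x []) (advInput x [])).mem 1 = x.length := by
  have hl : 0 < (advInput x []).length := by rw [length_advInput_nil]; omega
  have h : (init (advWordSize 1 x []) (advInput x [])).mem (0 + 1) =
      (advInput x [])[0]'hl % 2 ^ advWordSize 1 x [] := init_mem_succ _ _ 0 hl
  have hv : (advInput x [])[0]'hl = x.length := rfl
  rw [hv, Nat.mod_eq_of_lt (by have := succ_length_lt_two_pow x; omega)] at h
  exact h

/-- Cell `t + 2` initially holds the bit `x_t` (`t < n`). [folklore] -/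
theorem initMem_bit (t : ℕ) (ht : t < x.length) :
    (init (advWordSize 1 x []) (advInput x [])).mem (t + 2) = (x.getD t false).toNat := by
  have hl : t + 1 < (advInput x []).length := by rw [length_advInput_nil]; omega
  have h : (init (advWordSize 1 x []) (advInput x [])).mem (t + 1 + 1) =
      (advInput x [])[t + 1]'hl % 2 ^ advWordSize 1 x [] := init_mem_succ _ _ (t + 1) hl
  have hv : (advInput x [])[t + 1]'hl = (x.getD t false).toNat := by
    rw [List.getD_eq_getElem _ _ ht]
    simp [advInput]
  have h2 : (x.getD t false).toNat < 2 ^ advWordSize 1 x [] :=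
    lt_of_le_of_lt (Bool.toNat_le _) (by have := succ_length_lt_two_pow x; omega)
  rw [hv, Nat.mod_eq_of_lt h2] at h
  exact h

/-- Every cell from address `2` on initially holds a bit. [folklore] -/
theorem initMem_le_one (a : ℕ) (ha : 2 ≤ a) :
    (init (advWordSize 1 x []) (advInput x [])).mem a ≤ 1 := by
  by_cases h : a < x.length + 2
  · obtain ⟨t, rfl⟩ : ∃ t, a = t + 2 := ⟨a - 2, by omega⟩
    rw [initMem_bit x t (by omega)]
    exact Bool.toNat_le _
  · rw [init_mem_of_length_lt _ _ _ (by rw [length_advInput_nil]; omega)]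
    exact Nat.zero_le _

end initial

/-! ## The run on `x`, and the theorems -/

open Classical in
/-- **`palProg` on `x`**: it halts within `7·|x| + 7` steps (in fact `4·|x| + 7`) with output
`[1]` if `x ∈ PAL` and `[0]` otherwise — for every oracle and coin stream (it consults neither).
[folklore] -/
theorem palProg_run (x : List Bool) (O : List ℕ → List ℕ) (ρ : ℕ → ℕ) :
    ∃ s mf, s ≤ 7 * x.length + 7 ∧
      run palProg (advWordSize 1 x []) O ρ s (init (advWordSize 1 x []) (advInput x [])) =
        some (fin mf) ∧
      readOut mf = [if x ∈ PAL then 1 else 0] := by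
  have hinit : init (advWordSize 1 x []) (advInput x []) =
      mk 0 (init (advWordSize 1 x []) (advInput x [])).mem := rfl
  rw [hinit]
  generalize hM : (init (advWordSize 1 x []) (advInput x [])).mem = M
  generalize hW : advWordSize 1 x [] = W
  have hM0 : M 0 = x.length + 1 := by rw [← hM, initMem_zero]
  have hM1 : M 1 = x.length := by rw [← hM, initMem_one]
  have h2w : x.length + 1 < 2 ^ W := by rw [← hW]; exact succ_length_lt_two_pow x
  have hbit : ∀ t, t < x.length → M (t + 2) = (x.getD t false).toNat := by
    intro t ht; rw [← hM, initMem_bit x t ht]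
  have hbits : ∀ a, 2 ≤ a → M a ≤ 1 := by
    intro a ha; rw [← hM]; exact initMem_le_one x a ha
  by_cases hn0 : x.length = 0
  · -- `n = 0`: accept at once
    have e0 := step0_zero W O ρ M (by rw [hM1, hn0])
    have hrun : run palProg W O ρ (3 + 1) (mk 0 M) =
        some (fin (Function.update (Function.update M 0 1) 1 1)) := by
      rw [run_succ_of_step _ _ _ _ e0, run_acc]
    refine ⟨3 + 1, _, by omega, hrun, ?_⟩
    have hx : x = [] := List.eq_nil_of_length_eq_zero hn0
    rw [readOut_acc, if_pos (hx ▸ nil_mem_PAL)]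
  · have e0 := step0_ne W O ρ M (by rw [hM1]; exact hn0)
    have e1 := step1 W O ρ M
    rw [hM1] at e1
    by_cases hpar : x.length % 2 = 0
    · -- even length `≥ 2`: the loop
      have e2 := step2_zero W O ρ (Function.update M 1 (x.length % 2))
        (by rw [Function.update_self, hpar])
      have e4 := step4 W O ρ (Function.update M 1 (x.length % 2))
      rw [Function.update_idem] at e4
      have inv : LoopInv M (Function.update M 1 2) 2 (x.length + 1) :=
        ⟨by rw [Function.update_of_ne (by norm_num), hM0], Function.update_self ..,
          fun a ha => Function.update_of_ne (by omega) ..,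
          fun _ => Function.update_of_ne (by norm_num) ..⟩
      obtain ⟨s', mf, hs', hrun', hout'⟩ := loop_spec W O ρ M hbits (x.length / 2 - 1) 2
        (x.length + 1) (Function.update M 1 2) (by omega) le_rfl h2w inv
      have hpre : run palProg W O ρ (1 + 1 + 1 + 1) (mk 0 M) =
          some (mk 5 (Function.update M 1 2)) := by
        rw [run_succ_of_step _ _ _ _ e0, run_succ_of_step _ _ _ _ e1,
          run_succ_of_step _ _ _ _ e2, run_one, e4]
      refine ⟨1 + 1 + 1 + 1 + s', mf, by omega, run_add_of_run _ _ _ _ hpre hrun', ?_⟩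
      rw [hout']
      have key : ∀ a b : Bool, a.toNat = b.toNat → a = b := by decide
      have hiff : Mirror M 2 (x.length + 1) (x.length / 2 - 1 + 1) ↔ x ∈ PAL := by
        rw [show x.length / 2 - 1 + 1 = x.length / 2 by omega, mem_PAL_iff_mirror]
        constructor
        · intro h
          refine ⟨Nat.even_iff.2 hpar, fun t ht => ?_⟩
          have := h t ht
          rw [show 2 + t = t + 2 by omega,
            show x.length + 1 - t = (x.length - 1 - t) + 2 by omega, hbit t (by omega),
            hbit (x.length - 1 - t) (by omega)] at this
          exact key _ _ this
        · rintro ⟨-, h⟩ t ht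
          rw [show 2 + t = t + 2 by omega,
            show x.length + 1 - t = (x.length - 1 - t) + 2 by omega, hbit t (by omega),
            hbit (x.length - 1 - t) (by omega), h t ht]
      by_cases hP : x ∈ PAL
      · rw [if_pos hP, if_pos (hiff.2 hP)]
      · rw [if_neg hP, if_neg (fun h => hP (hiff.1 h))]
    · -- odd length: reject
      have e2 := step2_ne W O ρ (Function.update M 1 (x.length % 2))
        (by rw [Function.update_self]; exact hpar)
      have e3 := step3 W O ρ (Function.update M 1 (x.length % 2))
      have hrun : run palProg W O ρ (3 + 1 + 1 + 1 + 1) (mk 0 M) =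
          some (fin (Function.update (Function.update
            (Function.update M 1 (x.length % 2)) 0 1) 1 0)) := by
        rw [run_succ_of_step _ _ _ _ e0, run_succ_of_step _ _ _ _ e1,
          run_succ_of_step _ _ _ _ e2, run_succ_of_step _ _ _ _ e3, run_rej]
      refine ⟨3 + 1 + 1 + 1 + 1, _, by omega, hrun, ?_⟩
      rw [readOut_rej, if_neg ?_]
      intro hx
      obtain ⟨r, hr⟩ := even_length_of_mem_PAL hx
      omega

/-- **`palProg` decides `PAL` within `7·n + 7` steps** in the D16 conventions (`k = 1`, no
advice). [folklore] -/
theorem palProg_decides (x : List Bool) :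
    DecidesAdvWithin palProg 1 (fun _ => []) PAL x (7 * x.length + 7) := by
  classical
  obtain ⟨s, mf, hs, hrun, hout⟩ := palProg_run x noOracle zeroCoins
  refine ⟨decide (x ∈ PAL), by simp, ?_⟩
  have hb : [(decide (x ∈ PAL)).toNat] = readOut mf := by
    rw [hout]
    by_cases h : x ∈ PAL <;> simp [h]
  show OutputsWithin _ _ _ _ _ _ _
  rw [hb]
  exact outputsWithin_of_run hrun (step_fin _ _ _ _) hs

/-- **`PAL ∈ DTIME_RAM[n]`** on the word RAM of the census (class `DTIMERAM` of
`ChenJinWilliams2019/UniformAdviceRAM.lean`), by a verified program. [folklore] -/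
theorem PAL_mem_DTIMERAM : PAL ∈ DTIMERAM (fun n => n) :=
  ⟨palProg, 1, 7, palProg_isDeterministic, palProg_isOracleFree, fun x => palProg_decides x⟩

/-- `PAL ∈ NTIME_RAM[n]` (device D16e). [folklore] -/
theorem PAL_mem_NTIMERAM : PAL ∈ NTIMERAM (fun n => n) :=
  DTIMERAM_subset_NTIMERAM _ PAL_mem_DTIMERAM

/-- **`PAL ∈ NTIME_RAM[n^{1+o(1)}]`** — the hypothesis of the general theorem (Theorem 1.5,
`thm15_general`) at the printed instance. [folklore] -/
theorem PAL_mem_NTIMERAMAlmostLinear : PAL ∈ NTIMERAMAlmostLinear :=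
  DTIMERAM_subset_NTIMERAMAlmostLinear isAlmostLinear_id PAL_mem_DTIMERAM

/-- **The instance relation, unconditionally**: the typed general form of the one-tape refuter
magnification theorem (`thm15_general`, Theorem 1.5) implies its typed printed instance at the
palindromes (`thmPal_PNP`, Theorem (thm:pal)): print's "Now we are ready to generalize
Theorem (thm:pal) to other problems" (§3.3 p. 14 L25), as an implication in the tree.
[cite: ChenEtAl2022, §3.3 p.14 L25; p.13 L35] -/
theorem thmPal_PNP_of_thm15_general (h : thm15_general) : thmPal_PNP :=
  thmPal_PNP_of_general h PAL_mem_NTIMERAMAlmostLinear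

/-- Non-degeneracy of the word-RAM time classes beyond the constants: `DTIMERAM (fun n => n)`
contains a language that is neither `0` nor `⊤`. [folklore] -/
theorem exists_mem_DTIMERAM_ne : ∃ L ∈ DTIMERAM (fun n => n), L ≠ 0 ∧ L ≠ ⊤ :=
  ⟨PAL, PAL_mem_DTIMERAM, fun h => by simpa [h] using nil_mem_PAL,
    fun h => replicate_odd_not_mem_PAL 0 (by rw [h]; trivial)⟩

end Literature.Computability.MetaComplexity.ChenJinSanthanamWilliams2022
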